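import Mathlib
import Summits.FinalStateConjecture.FinalStateConjecture.Theorems.EIHFluxBalanceModulatedKerrHandoffDragDefectRicciExpansion
import Summits.FinalStateConjecture.FinalStateConjecture.Theorems.EIHFluxBalanceModulatedKerrHandoffDragDefectKSDecay
import Summits.FinalStateConjecture.FinalStateConjecture.Theorems.EIHFluxBalanceModulatedKerrHandoffDragDefectMinkowski
import Summits.FinalStateConjecture.FinalStateConjecture.Theorems.EIHFluxBalanceModulatedKerrHandoffDragDefectFields
import Summits.FinalStateConjecture.FinalStateConjecture.Theorems.EIHFluxBalanceModulatedKerrHandoffDragDefectDragErrorSecond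
import Summits.FinalStateConjecture.FinalStateConjecture.Theorems.EIHFluxBalanceModulatedKerrHandoffDragDefectSetup
import Summits.FinalStateConjecture.FinalStateConjecture.Theorems.EIHFluxBalanceModulatedKerrHandoffDragDefectArith
import Summits.FinalStateConjecture.FinalStateConjecture.Theorems.EIHFluxBalanceModulatedKerrHandoffDragDefectShell
import Summits.FinalStateConjecture.FinalStateConjecture.Theorems.EIHFluxBalanceInertialRecessionChartCalculus

/-!
# Route EIHFluxBalance — `ModulatedKerrHandoff`, stub `stub_dragDefect`: the drag defect

Proof of the registered stub `stub_dragDefect` (S2, line `overlap-modulation-second-iterate`) of the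
crux `stmt-FinalStateConjecture-10167` (`…Theses.EIHFluxBalance.ModulatedKerrHandoff`): universal
`C, d₀ > 0` with `‖Ric(F)(x)‖ ≤ C (M₁ + M₂)²/(D² ‖x̲‖²)` on hole 1's buffer shell for the
fixed-reference-event dragged superposition `F = η + h₁ + h₂ + L_X h₁` of two static Schwarzschild
Kerr–Schild fields. `ricAt_dragged_le_core`: `F = (1+A)^*g_{M₁,0} + k`, `k = (h₂ − h₂(0)) − AᵀηA + E`
(`…DragDefectFields`, `…DragDefectMinkowski`), `(1+A)^*g_{M₁,0}` Ricci-flat; the second-order Ricci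
expansion (`…DragDefectRicciExpansion`) about it with the inverse frozen to `η⁻¹` leaves the flat
principal part on `D²k = D²h₂ + D²E`, bounded by products for `D²h₂` (`…DragDefectShell`) and by the
`A`-quadratic jets of `E` (`…DragDefectDragError*`); jets from `…DragDefectSetup`, order count
`…DragDefectArith`.
-/

noncomputable section

-- `Summit.<S>.<S>.…` (single-problem summit, D-0017) trips core's duplicate-namespace linter.
set_option linter.dupNamespace false
set_option maxSynthPendingDepth 3

open Set Function Filter Metric ContinuousLinearMap Literature.Geometry.Lorentzian
  Literature.Geometry.Lorentzian.MetricCoord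
open Summit.FinalStateConjecture.FinalStateConjecture.Theorems.SublinearIsFree.Slaving
  (isMetricOn_kerr_bilin)
open scoped Topology ContDiff RealInnerProductSpace

namespace Summit.FinalStateConjecture.FinalStateConjecture.Theorems

namespace DragDefect

/-! ### The core estimate -/

-- nested operator norms of the iterated derivatives unify slowly
set_option maxHeartbeats 10000000 in
/-- **The drag defect, core form.** With the sharp Kerr–Schild decay constant `C_K ≥ 1` (the
property delivered by `exists_ksPert_jets_le`), for `0 < M₁, M₂`, hole 2 at `c₂` with `‖c₂̲‖ = D`,
a slab point `x` (`x⁰ = 0`) with `32 C_K² (M₁ + M₂) ≤ ‖x̲‖ = d` and `8d ≤ D`: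
`‖Ric(F)(x)‖ ≤ 3·10⁵ C_K² (M₁+M₂)²/(D² d²)` for the dragged superposition `F`. [folklore] -/
theorem ricAt_dragged_le_core {CK : ℝ} (hCK1 : 1 ≤ CK)
    (hKS : ∀ (M : ℝ) (c y : E4), 0 < E4.spatialNorm (y - c) →
      ‖Kerr.bilin M 0 (y - c) - Minkowski.bilin‖ ≤ CK * |M| / E4.spatialNorm (y - c) ∧
      ‖fderiv ℝ (fun z ↦ Kerr.bilin M 0 (z - c) - Minkowski.bilin) y‖ ≤
        CK * |M| / E4.spatialNorm (y - c) ^ 2 ∧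
      ‖fderiv ℝ (fderiv ℝ (fun z ↦ Kerr.bilin M 0 (z - c) - Minkowski.bilin)) y‖ ≤
        CK * |M| / E4.spatialNorm (y - c) ^ 3 ∧
      ∀ m ≤ 4, ‖iteratedFDeriv ℝ m (fun z ↦ Kerr.bilin M 0 (z - c) - Minkowski.bilin) y‖ ≤
        CK * |M| / E4.spatialNorm (y - c) ^ (m + 1))
    {M₁ M₂ D : ℝ} {c₂ x : E4} (hM₁ : 0 < M₁) (hM₂ : 0 < M₂) (hc₂ : E4.spatialNorm c₂ = D)
    (hx0 : x 0 = 0) (hsmall : 32 * CK ^ 2 * (M₁ + M₂) ≤ E4.spatialNorm x)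
    (hD : 8 * E4.spatialNorm x ≤ D) :
    ‖ricAt (fun y ↦ (Minkowski.bilin : E4 →L[ℝ] E4 →L[ℝ] ℝ) + (Kerr.bilin M₁ 0 y - Minkowski.bilin)
        + (Kerr.bilin M₂ 0 (y - c₂) - Minkowski.bilin)
        + (fderiv ℝ (fun z ↦ Kerr.bilin M₁ 0 z - Minkowski.bilin) y
            (((2⁻¹ : ℝ) • ((Minkowski.bilin : E4 →L[ℝ] E4 →L[ℝ] ℝ).inverse.comp
              (Kerr.bilin M₂ 0 (0 - c₂) - Minkowski.bilin))) y)
          + (Kerr.bilin M₁ 0 y - Minkowski.bilin).comp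
            ((2⁻¹ : ℝ) • ((Minkowski.bilin : E4 →L[ℝ] E4 →L[ℝ] ℝ).inverse.comp
              (Kerr.bilin M₂ 0 (0 - c₂) - Minkowski.bilin)))
          + (ContinuousLinearMap.precomp ℝ
            ((2⁻¹ : ℝ) • ((Minkowski.bilin : E4 →L[ℝ] E4 →L[ℝ] ℝ).inverse.comp
              (Kerr.bilin M₂ 0 (0 - c₂) - Minkowski.bilin)))).comp
            (Kerr.bilin M₁ 0 y - Minkowski.bilin))) x‖ ≤
      300000 * CK ^ 2 * (M₁ + M₂) ^ 2 / (D ^ 2 * E4.spatialNorm x ^ 2) := by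
  -- ## shell data and notation
  obtain ⟨⟨hd0, hD0, hεd⟩, ⟨hρx0, hq₀, hp₁, hp₂, hcstb, hcanc⟩, ⟨hcst_symm, ha, ha4, hAx, hxball, hρ₁0⟩,
    ⟨hN₀, hN, hh₁U⟩⟩ := shell_data hCK1 hKS norm_minkowski_inverse_le hM₁ hM₂ hc₂ hx0 hsmall hD
  set η : E4 →L[ℝ] E4 →L[ℝ] ℝ := Minkowski.bilin with hη
  set d := E4.spatialNorm x with hdd
  set cst : E4 →L[ℝ] E4 →L[ℝ] ℝ := Kerr.bilin M₂ 0 (0 - c₂) - η with hcst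
  set A : E4 →L[ℝ] E4 := (2⁻¹ : ℝ) • (η.inverse.comp cst) with hA
  set h₁ : E4 → E4 →L[ℝ] E4 →L[ℝ] ℝ := fun z ↦ Kerr.bilin M₁ 0 z - η with hh₁
  set Q : E4 → E4 →L[ℝ] E4 →L[ℝ] ℝ := fun z ↦ Kerr.bilin M₂ 0 (z - c₂) with hQ
  set L : E4 →L[ℝ] E4 := ContinuousLinearMap.id ℝ E4 + A with hL
  have hCK0 : 0 < CK := one_pos.trans_le hCK1
  set ε := CK * (M₁ + M₂) with hε
  have hε0 : 0 ≤ ε := by positivity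
  have hεd16 : 16 * ε ≤ d := by linarith
  have hK₁ε : CK * M₁ ≤ ε := by rw [hε]; nlinarith
  have hK₂ε : CK * M₂ ≤ ε := by rw [hε]; nlinarith
  have hK₁0 : 0 ≤ CK * M₁ := by positivity
  have ha1 : ‖A‖ ≤ 1 := ha4.trans (by norm_num)
  have hxball0 : x ∈ ball x (d / 2) := mem_ball_self (by positivity)
  obtain ⟨hE₀, hE₁, hE₂⟩ := norm_iteratedFDeriv_dragError_le hh₁U hxball0 hxball ha1 hN₀
    (hN 1 (by norm_num)) (hN 2 (by norm_num)) (hN 3 (by norm_num)) (hN 4 (by norm_num))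
  obtain ⟨hG₀, hG₁, hG₂⟩ := norm_iteratedFDeriv_pullback_le hh₁U hxball0 hxball ha1 hN₀
    (hN 1 (by norm_num)) (hN 2 (by norm_num))
  -- ## algebra: the Lie drag of `η`, the affine pull-back, the difference identity
  have hdrag : η.comp A + (ContinuousLinearMap.precomp ℝ A).comp η = cst :=
    minkowski_lieDrag_eq cst hcst_symm
  have hpullη : η.bilinearComp L L =
      η + cst + (ContinuousLinearMap.precomp ℝ A).comp (η.comp A) :=
    minkowski_pullback_id_add cst hcst_symm
  set g₁ : E4 → E4 →L[ℝ] E4 →L[ℝ] ℝ := pullMetric (Kerr.bilin M₁ 0) (fun z : E4 ↦ z + A z)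
    with hg₁
  set G : E4 → E4 →L[ℝ] E4 →L[ℝ] ℝ := fun y ↦ (h₁ (y + A y)).bilinearComp L L with hG
  set Ed : E4 → E4 →L[ℝ] E4 →L[ℝ] ℝ := fun y ↦ h₁ y + fderiv ℝ h₁ y (A y) + (h₁ y).comp A
      + (ContinuousLinearMap.precomp ℝ A).comp (h₁ y) - (h₁ (y + A y)).bilinearComp L L with hEd
  set Mc : E4 →L[ℝ] E4 →L[ℝ] ℝ := (ContinuousLinearMap.precomp ℝ A).comp (η.comp A) with hMc
  have hg₁_apply : ∀ y, g₁ y = (Kerr.bilin M₁ 0 (y + A y)).bilinearComp L L := fun y ↦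
    pullMetric_affine (Kerr.bilin M₁ 0) A y
  have hg₁_split : ∀ y, g₁ y = (η + cst + Mc) + G y := by
    intro y
    rw [hg₁_apply, ← hpullη, hG]
    simp only
    rw [← add_bilinearComp, hh₁]
    simp only [add_sub_cancel]
  set F : E4 → E4 →L[ℝ] E4 →L[ℝ] ℝ := fun y ↦ η + (Kerr.bilin M₁ 0 y - η)
      + (Kerr.bilin M₂ 0 (y - c₂) - η)
      + (fderiv ℝ h₁ y (A y) + (Kerr.bilin M₁ 0 y - η).comp A
        + (ContinuousLinearMap.precomp ℝ A).comp (Kerr.bilin M₁ 0 y - η)) with hF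
  have hkey : ∀ y, F y - g₁ y = (Q y - η - cst) - Mc + Ed y := by
    intro y
    rw [hg₁_apply]
    exact dragged_sub_pullback (Kerr.bilin M₁ 0) Q η cst A hdrag y
  -- ## metric structures and the common open domain
  have hP : IsMetricOn (Kerr.bilin M₁ 0) (Kerr.region 0 0 : Set E4) := isMetricOn_kerr_bilin M₁ 0
  have hQm : IsMetricOn Q {y : E4 | 0 < E4.spatialNorm (y - c₂)} := isMetricOn_kerr_sub M₂ c₂
  have hFm : IsMetricOn F {y : E4 | y ∈ (Kerr.region 0 0 : Set E4) ∩
      {y : E4 | 0 < E4.spatialNorm (y - c₂)} ∧ (F y).IsInvertible} :=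
    isMetricOn_dragged hP hQm
  have hAinv : (ContinuousLinearMap.id ℝ E4 + A).IsInvertible :=
    isInvertible_id_add (ha4.trans_lt (by norm_num))
  have hg₁m : IsMetricOn g₁ ((fun y : E4 ↦ y + A y) ⁻¹' (Kerr.region 0 0 : Set E4)) :=
    isMetricOn_pullback_kerr M₁ hAinv
  set V : Set E4 := {y : E4 | y ∈ (Kerr.region 0 0 : Set E4) ∩
      {y : E4 | 0 < E4.spatialNorm (y - c₂)} ∧ (F y).IsInvertible} ∩
      ((fun y : E4 ↦ y + A y) ⁻¹' (Kerr.region 0 0 : Set E4)) with hV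
  have hVo : IsOpen V := hFm.isOpen.inter hg₁m.isOpen
  have hFV : IsMetricOn F V := KerrSchildChart.isMetricOn_mono hFm hVo inter_subset_left
  have hg₁V : IsMetricOn g₁ V := KerrSchildChart.isMetricOn_mono hg₁m hVo inter_subset_right
  have hGx : ‖G x‖ ≤ 4 * (CK * M₁ * (2 / d)) := hG₀
  have hMc : ‖Mc‖ ≤ ‖A‖ ^ 2 := norm_AetaA_le A
  obtain ⟨ha2s, hK8s, hK2s, hK1s, hKas⟩ := shell_small hd0 hD hεd hε0 (norm_nonneg A) ha hK₁ε
  obtain ⟨-, -, hK2s', hK1s', -⟩ := shell_small hd0 hD hεd hε0 (norm_nonneg A) ha hK₂ε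
  obtain ⟨jE₀, jE₁, jE₂⟩ := jets_to_arith hK₁0 (norm_nonneg A) (norm_nonneg (A x)) hAx hd0
  have hE₀' : ‖Ed x‖ ≤ 18 * (CK * M₁) * ‖A‖ ^ 2 / d := hE₀.trans jE₀
  have hE₁' : ‖iteratedFDeriv ℝ 1 Ed x‖ ≤ 56 * (CK * M₁) * ‖A‖ ^ 2 / d ^ 2 := hE₁.trans jE₁
  have hE₂' : ‖iteratedFDeriv ℝ 2 Ed x‖ ≤ 184 * (CK * M₁) * ‖A‖ ^ 2 / d ^ 3 := hE₂.trans jE₂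
  have hg₁η : ‖g₁ x - η‖ ≤ CK * M₂ / D + ‖A‖ ^ 2 + 8 * (CK * M₁) / d := by
    rw [hg₁_split x, show η + cst + Mc + G x - η = cst + Mc + G x by abel]
    calc _ ≤ ‖cst‖ + ‖Mc‖ + ‖G x‖ := norm_add₃_le
      _ ≤ CK * M₂ / D + ‖A‖ ^ 2 + 4 * (CK * M₁ * (2 / d)) := add_le_add (add_le_add hcstb hMc) hGx
      _ = _ := by ring
  have hg₁η' : ‖g₁ x - η‖ ≤ 2⁻¹ := by
    have : 8 * (CK * M₁) / d ≤ 4⁻¹ := hK8s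
    linarith [hg₁η, hK1s', ha2s]
  have hFg₁ : ‖F x - g₁ x‖ ≤ 4 * (CK * M₂) * d / D ^ 2 + ‖A‖ ^ 2 + ‖Ed x‖ := by
    rw [hkey x]
    calc _ ≤ ‖Q x - η - cst‖ + ‖Mc‖ + ‖Ed x‖ :=
          (norm_add_le _ _).trans (add_le_add (norm_sub_le _ _) le_rfl)
      _ ≤ _ := add_le_add (add_le_add ?_ hMc) le_rfl
    have e : Q x - η - cst = (Kerr.bilin M₂ 0 (x - c₂) - Minkowski.bilin)
        - (Kerr.bilin M₂ 0 (0 - c₂) - Minkowski.bilin) := by rw [hQ, hcst, hη]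
    rw [e]
    refine hcanc.trans ?_
    rw [hdd]
    exact div_le_div_of_nonneg_right (by nlinarith [E4.spatialNorm_nonneg x]) (by positivity)
  have hFη : ‖F x - η‖ ≤ 2⁻¹ := by
    have e : F x - η = (Q x - η) + Ed x + G x := by
      have h1 := hkey x
      have h2 := hg₁_split x
      have : F x - η = (F x - g₁ x) + (g₁ x - η) := by abel
      rw [this, h1, h2]; abel
    rw [e]
    have hQx : ‖Q x - η‖ ≤ 16⁻¹ := hq₀.trans hK2s'
    have hEdx : ‖Ed x‖ ≤ 16⁻¹ := hE₀'.trans hKas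
    have hGx' : ‖G x‖ ≤ 4⁻¹ := hGx.trans (by
      have : 4 * (CK * M₁ * (2 / d)) = 8 * (CK * M₁) / d := by ring
      rw [this]; exact hK8s)
    calc _ ≤ ‖Q x - η‖ + ‖Ed x‖ + ‖G x‖ := norm_add₃_le
      _ ≤ 16⁻¹ + 16⁻¹ + 4⁻¹ := add_le_add (add_le_add hQx hEdx) hGx'
      _ ≤ 2⁻¹ := by norm_num
  have hFinv : (F x).IsInvertible := by
    have e : F x = η + (F x - η) := by abel
    rw [e]; exact isInvertible_minkowski_add hFη
  have hxV : x ∈ V := by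
    refine ⟨⟨⟨?_, hρx0⟩, hFinv⟩, ?_⟩
    · rw [mem_region_zero_iff]; exact hd0
    · rw [mem_preimage, mem_region_zero_iff]; exact hρ₁0
  have hsF : ‖sharpAt F x‖ ≤ 2 := by
    have e : F x = η + (F x - η) := by abel
    rw [sharpAt, e]; exact norm_inverse_minkowski_add_le hFη
  have hsg₁ : ‖sharpAt g₁ x‖ ≤ 2 := by
    have e : g₁ x = η + (g₁ x - η) := by abel
    rw [sharpAt, e]; exact norm_inverse_minkowski_add_le hg₁η'
  have hfreeze : ‖sharpAt g₁ x - η.inverse‖ ≤ 2 * (CK * M₂ / D + ‖A‖ ^ 2 + 8 * (CK * M₁) / d) := by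
    have h := MetricCoord.norm_sharpAt_sub_le (G := g₁) (G' := fun _ : E4 ↦ η) (x := x)
      (hg₁V.isInvertible x hxV) minkowski_isInvertible
    calc _ ≤ ‖sharpAt g₁ x‖ * ‖g₁ x - η‖ * ‖η.inverse‖ := h
      _ ≤ 2 * (CK * M₂ / D + ‖A‖ ^ 2 + 8 * (CK * M₁) / d) * 1 := by
          gcongr
          exact norm_minkowski_inverse_le
      _ = _ := by ring
  -- ## smoothness on a common open set and the derivative identities at `x`
  set O : Set E4 := ((Kerr.region 0 0 : Set E4) ∩ {y : E4 | 0 < E4.spatialNorm (y - c₂)}) ∩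
      ((fun y : E4 ↦ y + A y) ⁻¹' (Kerr.region 0 0 : Set E4)) with hO
  have hOo : IsOpen O := (hP.isOpen.inter hQm.isOpen).inter hg₁m.isOpen
  have hxO : x ∈ O := ⟨⟨by rw [mem_region_zero_iff]; exact hd0, hρx0⟩,
    by rw [mem_preimage, mem_region_zero_iff]; exact hρ₁0⟩
  have hFsm : ∀ y ∈ O, ContDiffAt ℝ ∞ F y := fun y hy ↦ contDiffAt_dragged hP hQm hy.1.1 hy.1.2
  have hg₁sm : ∀ y ∈ O, ContDiffAt ℝ ∞ g₁ y := fun y hy ↦ hg₁m.contDiffAt hy.2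
  have hQsm : ∀ y ∈ O, ContDiffAt ℝ ∞ Q y := fun y hy ↦ hQm.contDiffAt hy.1.2
  set Qc : E4 → E4 →L[ℝ] E4 →L[ℝ] ℝ := fun y ↦ Q y - η - cst - Mc with hQc
  have hQcsm : ∀ y ∈ O, ContDiffAt ℝ ∞ Qc y := fun y hy ↦
    (((hQsm y hy).sub contDiffAt_const).sub contDiffAt_const).sub contDiffAt_const
  have hEd_eq : Ed = fun y ↦ (F y - g₁ y) - Qc y := by
    funext y; simp only [hkey y, hQc]; abel
  have hEdsm : ∀ y ∈ O, ContDiffAt ℝ ∞ Ed y := fun y hy ↦ by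
    rw [hEd_eq]; exact ((hFsm y hy).sub (hg₁sm y hy)).sub (hQcsm y hy)
  have hk_eq : (fun y ↦ F y - g₁ y) = fun y ↦ Qc y + Ed y := by
    funext y; simp only [hkey y, hQc]
  have hQd : HasFDerivAt Q (fderiv ℝ Q x) x :=
    ((hQsm x hxO).differentiableAt (by simp)).hasFDerivAt
  have hEdd : HasFDerivAt Ed (fderiv ℝ Ed x) x :=
    ((hEdsm x hxO).differentiableAt (by simp)).hasFDerivAt
  have hg₁d : HasFDerivAt g₁ (fderiv ℝ g₁ x) x :=
    ((hg₁sm x hxO).differentiableAt (by simp)).hasFDerivAt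
  have hkd : HasFDerivAt (fun y ↦ F y - g₁ y) (fderiv ℝ Q x + fderiv ℝ Ed x) x := by
    rw [hk_eq]
    have h : HasFDerivAt (fun y ↦ Q y - η - cst - Mc + Ed y) (fderiv ℝ Q x + fderiv ℝ Ed x) x :=
      (((hQd.sub_const η).sub_const cst).sub_const Mc).add hEdd
    exact h
  have hDF : fderiv ℝ F x = fderiv ℝ g₁ x + (fderiv ℝ Q x + fderiv ℝ Ed x) := by
    have h : HasFDerivAt (fun y ↦ g₁ y + (F y - g₁ y))
        (fderiv ℝ g₁ x + (fderiv ℝ Q x + fderiv ℝ Ed x)) x := hg₁d.add hkd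
    have e : (fun y ↦ g₁ y + (F y - g₁ y)) = F := funext fun y ↦ add_sub_cancel _ _
    rw [e] at h
    exact h.fderiv
  have hfQc : fderiv ℝ Qc = fderiv ℝ Q := by
    funext y; rw [hQc]; simp only [fderiv_sub_const]
  have hT : fderiv ℝ (fderiv ℝ F) x - fderiv ℝ (fderiv ℝ g₁) x =
      fderiv ℝ (fderiv ℝ Q) x + fderiv ℝ (fderiv ℝ Ed) x := by
    rw [← KerrSchildChart.fderiv_fderiv_sub_of_isOpen hOo hFsm hg₁sm hxO, hk_eq,
      fderiv_fderiv_add_of_isOpen hOo hQcsm hEdsm hxO, hfQc]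
  have hD2F : fderiv ℝ (fderiv ℝ F) x =
      fderiv ℝ (fderiv ℝ g₁) x + (fderiv ℝ (fderiv ℝ Q) x + fderiv ℝ (fderiv ℝ Ed) x) := by
    rw [← hT]; abel
  have hg₁G : fderiv ℝ g₁ = fderiv ℝ G := by
    have e : g₁ = fun y ↦ (η + cst + Mc) + G y := funext hg₁_split
    rw [e]; funext y; exact fderiv_const_add _
  have hb₁ : ‖fderiv ℝ g₁ x‖ ≤ 32 * (CK * M₁) / d ^ 2 := by
    rw [hg₁G, norm_fderiv_eq]
    refine hG₁.trans (le_of_eq ?_)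
    norm_num only [div_pow]; field_simp; ring
  have hb₂ : ‖fderiv ℝ (fderiv ℝ g₁) x‖ ≤ 128 * (CK * M₁) / d ^ 3 := by
    rw [hg₁G, norm_fderiv_fderiv_eq]
    refine hG₂.trans (le_of_eq ?_)
    norm_num only [div_pow]; field_simp; ring
  have hfh₂ : fderiv ℝ (fun z ↦ Kerr.bilin M₂ 0 (z - c₂) - Minkowski.bilin) = fderiv ℝ Q := by
    funext y; rw [hQ]; exact fderiv_sub_const _
  rw [hfh₂] at hp₁ hp₂
  have hp₁' : ‖fderiv ℝ Q x‖ ≤ 4 * (CK * M₂) / D ^ 2 := by convert hp₁ using 2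
  have hp₂' : ‖fderiv ℝ (fderiv ℝ Q) x‖ ≤ 8 * (CK * M₂) / D ^ 3 := by convert hp₂ using 2
  have hE₁eq : ‖fderiv ℝ Ed x‖ = ‖iteratedFDeriv ℝ 1 Ed x‖ := norm_fderiv_eq Ed x
  have hE₂eq : ‖fderiv ℝ (fderiv ℝ Ed) x‖ = ‖iteratedFDeriv ℝ 2 Ed x‖ := norm_fderiv_fderiv_eq Ed x
  have hH₁ : ‖fderiv ℝ Q x + fderiv ℝ Ed x‖ ≤ 4 * (CK * M₂) / D ^ 2 + ‖iteratedFDeriv ℝ 1 Ed x‖ :=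
    (norm_add_le (fderiv ℝ Q x) (fderiv ℝ Ed x)).trans (add_le_add hp₁' hE₁eq.le)
  have hE₂n : ‖fderiv ℝ (fderiv ℝ Ed) x‖ ≤ 184 * (CK * M₁) * ‖A‖ ^ 2 / d ^ 3 := by
    rw [hE₂eq]; exact hE₂'
  have hH₂ : ‖fderiv ℝ (fderiv ℝ Q) x + fderiv ℝ (fderiv ℝ Ed) x‖ ≤ 8 * (CK * M₂) / D ^ 3 + ‖iteratedFDeriv ℝ 2 Ed x‖ :=
    (norm_add_le (fderiv ℝ (fderiv ℝ Q) x) (fderiv ℝ (fderiv ℝ Ed) x)).trans (add_le_add hp₂' hE₂eq.le)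
  have hH₁' : ‖fderiv ℝ F x - fderiv ℝ g₁ x‖ ≤ 4 * (CK * M₂) / D ^ 2 + ‖iteratedFDeriv ℝ 1 Ed x‖ := by
    rw [hDF, add_sub_cancel_left]; exact hH₁
  have hH₂' : ‖fderiv ℝ (fderiv ℝ F) x - fderiv ℝ (fderiv ℝ g₁) x‖ ≤ 8 * (CK * M₂) / D ^ 3 + ‖iteratedFDeriv ℝ 2 Ed x‖ := by
    rw [hT]; exact hH₂
  have hDF_le : ‖fderiv ℝ F x‖ ≤ ‖fderiv ℝ g₁ x‖ + ‖fderiv ℝ F x - fderiv ℝ g₁ x‖ := by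
    have e : fderiv ℝ F x = fderiv ℝ g₁ x + (fderiv ℝ F x - fderiv ℝ g₁ x) := by abel
    exact (congrArg norm e).le.trans (norm_add_le (fderiv ℝ g₁ x) (fderiv ℝ F x - fderiv ℝ g₁ x))
  have hDg₁_le : ‖fderiv ℝ g₁ x‖ ≤ ‖fderiv ℝ g₁ x‖ + ‖fderiv ℝ F x - fderiv ℝ g₁ x‖ :=
    le_add_of_nonneg_right (norm_nonneg _)
  have hD2F_le : ‖fderiv ℝ (fderiv ℝ F) x‖ ≤ ‖fderiv ℝ (fderiv ℝ g₁) x‖ + ‖fderiv ℝ (fderiv ℝ F) x - fderiv ℝ (fderiv ℝ g₁) x‖ := by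
    have e : fderiv ℝ (fderiv ℝ F) x = fderiv ℝ (fderiv ℝ g₁) x + (fderiv ℝ (fderiv ℝ F) x - fderiv ℝ (fderiv ℝ g₁) x) := by abel
    exact (congrArg norm e).le.trans (norm_add_le (fderiv ℝ (fderiv ℝ g₁) x) (fderiv ℝ (fderiv ℝ F) x - fderiv ℝ (fderiv ℝ g₁) x))
  -- ## the two second-order Ricci expansions
  set σ : (E4 →L[ℝ] ℝ) →L[ℝ] E4 := η.inverse with hσ
  set bs := EuclideanSpace.basisFun (Fin 4) ℝ with hbs
  have hσ1 : ‖σ‖ ≤ 1 := norm_minkowski_inverse_le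
  have hRicg₁ : ricAt g₁ x = 0 := ricAt_pullback_kerr_eq_zero M₁ hAinv hρ₁0
  have hYZn : ∀ Y Z : E4, 0 ≤ ‖Y‖ * ‖Z‖ := fun Y Z ↦ mul_nonneg (norm_nonneg Y) (norm_nonneg Z)
  have R1 : ∀ Y Z : E4, |ricAt F x Y Z - ∑ i, ⟪bs i, (2⁻¹ : ℝ) • (σ (koszulOp ((fderiv ℝ (fderiv ℝ F) x - fderiv ℝ (fderiv ℝ g₁) x) (bs i)) Y Z) - σ (koszulOp ((fderiv ℝ (fderiv ℝ F) x - fderiv ℝ (fderiv ℝ g₁) x) Y) (bs i) Z))⟫| ≤ 4 * ((120 * (‖fderiv ℝ g₁ x‖ + ‖fderiv ℝ F x - fderiv ℝ g₁ x‖) ^ 2 + 12 * (‖fderiv ℝ (fderiv ℝ g₁) x‖ + ‖fderiv ℝ (fderiv ℝ F) x - fderiv ℝ (fderiv ℝ g₁) x‖)) * ‖F x - g₁ x‖ + 60 * (‖fderiv ℝ g₁ x‖ + ‖fderiv ℝ F x - fderiv ℝ g₁ x‖) * ‖fderiv ℝ F x - fderiv ℝ g₁ x‖ + 6 * (CK *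 M₂ / D + ‖A‖ ^ 2 + 8 * (CK * M₁) / d) * ‖fderiv ℝ (fderiv ℝ F) x - fderiv ℝ (fderiv ℝ g₁) x‖) * (‖Y‖ * ‖Z‖) := by
    intro Y Z
    have h := dragDefect_ricci_expansion hFV hg₁V hxV (s := 2)
      (a₁ := ‖fderiv ℝ g₁ x‖ + ‖fderiv ℝ F x - fderiv ℝ g₁ x‖)
      (a₂ := ‖fderiv ℝ (fderiv ℝ g₁) x‖ + ‖fderiv ℝ (fderiv ℝ F) x - fderiv ℝ (fderiv ℝ g₁) x‖)
      hsF hsg₁ hDF_le hDg₁_le hD2F_le σ Y Z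
    rw [hRicg₁] at h
    simp only [_root_.zero_apply, sub_zero, Fintype.card_fin, Nat.cast_ofNat] at h
    refine h.trans ?_
    have e : 3 * ‖sharpAt g₁ x - σ‖ * ‖fderiv ℝ (fderiv ℝ F) x - fderiv ℝ (fderiv ℝ g₁) x‖
        * (‖Y‖ * ‖Z‖) ≤ 6 * (CK * M₂ / D + ‖A‖ ^ 2 + 8 * (CK * M₁) / d)
        * ‖fderiv ℝ (fderiv ℝ F) x - fderiv ℝ (fderiv ℝ g₁) x‖ * (‖Y‖ * ‖Z‖) := by
      refine mul_le_mul_of_nonneg_right (mul_le_mul_of_nonneg_right ?_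
        (norm_nonneg (fderiv ℝ (fderiv ℝ F) x - fderiv ℝ (fderiv ℝ g₁) x))) (hYZn Y Z)
      linarith only [hfreeze]
    linarith only [e]
  -- expansion for the pair `(η + h₂, η)`: the principal part on `D²h₂` is a sum of products
  have R2 := fun Y Z : E4 ↦ far_hole_principal_le M₂ c₂ hρx0 hd0 (hq₀.trans (hK2s'.trans (by norm_num))) Y Z
  have R3 : ∀ Y Z : E4, |∑ i, ⟪bs i, (2⁻¹ : ℝ) • (σ (koszulOp ((fderiv ℝ (fderiv ℝ Ed) x) (bs i)) Y Z) - σ (koszulOp ((fderiv ℝ (fderiv ℝ Ed) x) Y) (bs i) Z))⟫| ≤ 12 * ‖iteratedFDeriv ℝ 2 Ed x‖ * (‖Y‖ * ‖Z‖) := by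
    intro Y Z
    have h := abs_prin_le bs σ (fderiv ℝ (fderiv ℝ Ed) x) Y Z
    simp only [Fintype.card_fin, Nat.cast_ofNat] at h
    refine h.trans ?_
    rw [hE₂eq]
    have e : ‖σ‖ * ‖iteratedFDeriv ℝ 2 Ed x‖ * (‖Y‖ * ‖Z‖) ≤ 1 * ‖iteratedFDeriv ℝ 2 Ed x‖ * (‖Y‖ * ‖Z‖) :=
      mul_le_mul_of_nonneg_right (mul_le_mul_of_nonneg_right hσ1 (norm_nonneg _)) (hYZn Y Z)
    linarith only [e]
  have hsplit : ∀ Y Z : E4, ∑ i, ⟪bs i, (2⁻¹ : ℝ) • (σ (koszulOp ((fderiv ℝ (fderiv ℝ F) x - fderiv ℝ (fderiv ℝ g₁) x) (bs i)) Y Z) - σ (koszulOp ((fderiv ℝ (fderiv ℝ F) x - fderiv ℝ (fderiv ℝ g₁) x) Y) (bs i) Z))⟫ = ∑ i, ⟪bs i, (2⁻¹ : ℝ) • (σ (koszulOp ((fderiv ℝ (fderiv ℝ Q) x) (bs i)) Y Z) - σ (koszulOp ((fderiv ℝ (fderiv ℝ Q) x) Y) (bs i) Z))⟫ + ∑ i,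 ⟪bs i, (2⁻¹ : ℝ) • (σ (koszulOp ((fderiv ℝ (fderiv ℝ Ed) x) (bs i)) Y Z) - σ (koszulOp ((fderiv ℝ (fderiv ℝ Ed) x) Y) (bs i) Z))⟫ := by
    intro Y Z
    have h := prin_add bs σ (fderiv ℝ (fderiv ℝ Q) x) (fderiv ℝ (fderiv ℝ Ed) x) Y Z
    rw [← hT] at h
    exact h
  have hcount := dragDefect_order_count (ε := ε) (d := d) (D := D) (K₁ := CK * M₁) (K₂ := CK * M₂)
    (a := ‖A‖) (E₀ := ‖Ed x‖) (E₁ := ‖iteratedFDeriv ℝ 1 Ed x‖) (E₂ := ‖iteratedFDeriv ℝ 2 Ed x‖)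
    (H₀ := ‖F x - g₁ x‖) (H₁ := ‖fderiv ℝ F x - fderiv ℝ g₁ x‖)
    (H₂ := ‖fderiv ℝ (fderiv ℝ F) x - fderiv ℝ (fderiv ℝ g₁) x‖) (b₁ := ‖fderiv ℝ g₁ x‖)
    (b₂ := ‖fderiv ℝ (fderiv ℝ g₁) x‖) (g := CK * M₂ / D + ‖A‖ ^ 2 + 8 * (CK * M₁) / d)
    (p₁ := ‖fderiv ℝ Q x‖) (p₂ := ‖fderiv ℝ (fderiv ℝ Q) x‖) (q₀ := ‖Q x - η‖)
    hd0 hD hεd16 hε0 hK₁ε hK₂ε (norm_nonneg A) ha hE₀' hE₁' hE₂' (norm_nonneg (F x - g₁ x)) hFg₁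
    (norm_nonneg (fderiv ℝ F x - fderiv ℝ g₁ x)) hH₁'
    (norm_nonneg (fderiv ℝ (fderiv ℝ F) x - fderiv ℝ (fderiv ℝ g₁) x)) hH₂'
    (norm_nonneg (fderiv ℝ g₁ x)) hb₁ hb₂ (by gcongr)
    (norm_nonneg (fderiv ℝ Q x)) hp₁' hp₂' (norm_nonneg (Q x - η)) hq₀
  have hB0 : 0 ≤ 300000 * ε ^ 2 / (D ^ 2 * d ^ 2) := by positivity
  have hric : ∀ Y Z : E4, |ricAt F x Y Z| ≤ 300000 * ε ^ 2 / (D ^ 2 * d ^ 2) * ‖Y‖ * ‖Z‖ := by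
    intro Y Z
    have h := abs_le_of_split (R1 Y Z) (hsplit Y Z) (R2 Y Z) (R3 Y Z)
    have key := mul_le_mul_of_nonneg_right hcount (hYZn Y Z)
    have hW : 300000 * ε ^ 2 / (D ^ 2 * d ^ 2) * ‖Y‖ * ‖Z‖ =
        300000 * ε ^ 2 / (D ^ 2 * d ^ 2) * (‖Y‖ * ‖Z‖) := by ring
    rw [hW]
    linarith only [h, key]
  have hfinal : ‖ricAt F x‖ ≤ 300000 * ε ^ 2 / (D ^ 2 * d ^ 2) := by
    refine opNorm_le_bound₂ _ hB0 fun Y Z ↦ ?_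
    rw [Real.norm_eq_abs]; exact hric Y Z
  calc ‖ricAt F x‖ ≤ 300000 * ε ^ 2 / (D ^ 2 * d ^ 2) := hfinal
    _ = 300000 * CK ^ 2 * (M₁ + M₂) ^ 2 / (D ^ 2 * d ^ 2) := by rw [hε]; ring

end DragDefect

end Summit.FinalStateConjecture.FinalStateConjecture.Theorems

/-! ### The registered stub -/

namespace Summit.FinalStateConjecture.FinalStateConjecture.Cruxes.ModulatedKerrHandoff.OverlapModulationSecondIterate

open scoped Manifold ContDiff Topology BigOperators ENNReal
open Set Function Filter TopologicalSpace Literature.Geometry.Lorentzian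
open Summit.FinalStateConjecture.FinalStateConjecture.Theorems
  Summit.FinalStateConjecture.FinalStateConjecture.Theorems.DragDefect

/-- **STUB S2 · `stub_dragDefect`** of the line `overlap-modulation-second-iterate` of the crux
`EIHFluxBalance.ModulatedKerrHandoff`: universal `C, d₀ > 0` such that on hole 1's buffer shell
`d₀(M₁ + M₂) ≤ ‖x̲‖ ≤ D/8` of the reference slab, the coordinate Ricci form of the fixed-reference-event
dragged superposition of two static Schwarzschild Kerr–Schild fields is
`≤ C (M₁ + M₂)²/(D² ‖x̲‖²)` (`ricAt_dragged_le_core` with the sharp decay constant of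
`exists_ksPert_jets_le`; `C = 3·10⁵ C_K²`, `d₀ = 32 C_K²`). [folklore] -/
theorem stub_dragDefect : open Literature.Geometry.Lorentzian in ∃ C d₀ : ℝ, 0 < C ∧ 0 < d₀ ∧ ∀ (M₁ M₂ Dsep : ℝ) (e : E3), 0 < M₁ → 0 < M₂ → ‖e‖ = 1 → ∀ x : E4, x 0 = 0 → d₀ * (M₁ + M₂) ≤ E4.spatialNorm x → 8 * E4.spatialNorm x ≤ Dsep → ‖MetricCoord.ricAt (fun y ↦ Minkowski.bilin + (boostedKerrBilin 1 0 M₁ 0 y - Minkowski.bilin) + (boostedKerrBilin 1 (E4.ofTimeSpace 0 (Dsep • e)) M₂ 0 y - Minkowski.bilin) + (fderiv ℝ (fun z ↦ boostedKerrBilin 1 0 M₁ 0 z - Minkowski.bilin) y (((2⁻¹ : ℝ) • ((Minkowski.bilin : E4 →L[ℝ] E4 →L[ℝ] ℝ).inverse.comp (boostedKerrBilin 1 (E4.ofTimeSpace 0 (Dsep • e)) M₂ 0 0 - Minkowski.bilin))) (y - 0)) + (boostedKerrBilin 1 0 M₁ 0 y - Minkowski.bilin).comp ((2⁻¹ : ℝ)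 • ((Minkowski.bilin : E4 →L[ℝ] E4 →L[ℝ] ℝ).inverse.comp (boostedKerrBilin 1 (E4.ofTimeSpace 0 (Dsep • e)) M₂ 0 0 - Minkowski.bilin))) + (ContinuousLinearMap.precomp ℝ ((2⁻¹ : ℝ) • ((Minkowski.bilin : E4 →L[ℝ] E4 →L[ℝ] ℝ).inverse.comp (boostedKerrBilin 1 (E4.ofTimeSpace 0 (Dsep • e)) M₂ 0 0 - Minkowski.bilin)))).comp (boostedKerrBilin 1 0 M₁ 0 y - Minkowski.bilin))) x‖ ≤ C * (M₁ + M₂) ^ 2 / (Dsep ^ 2 * E4.spatialNorm x ^ 2) := by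
  obtain ⟨C₀, hC₀0, hC₀⟩ := exists_ksPert_jets_le
  refine ⟨300000 * (max C₀ 1) ^ 2, 32 * (max C₀ 1) ^ 2, by positivity, by positivity, ?_⟩
  intro M₁ M₂ Dsep e hM₁ hM₂ he x hx0 hd hD
  have hCK1 : 1 ≤ max C₀ 1 := le_max_right _ _
  have hle : ∀ (M ρ : ℝ) (k : ℕ), 0 < ρ → C₀ * |M| / ρ ^ k ≤ max C₀ 1 * |M| / ρ ^ k :=
    fun M ρ k hρ ↦ by gcongr; exact le_max_left _ _
  have hKS : ∀ (M : ℝ) (c y : E4), 0 < E4.spatialNorm (y - c) → ‖Kerr.bilin M 0 (y - c) - Minkowski.bilin‖ ≤ max C₀ 1 * |M| / E4.spatialNorm (y - c) ∧ ‖fderiv ℝ (fun z ↦ Kerr.bilin M 0 (z - c) - Minkowski.bilin) y‖ ≤ max C₀ 1 * |M| / E4.spatialNorm (y - c) ^ 2 ∧ ‖fderiv ℝ (fderiv ℝ (fun z ↦ Kerr.bilin M 0 (z - c) - Minkowski.bilin)) y‖ ≤ max C₀ 1 * |M| / E4.spatialNorm (y - c) ^ 3 ∧ ∀ m ≤ 4,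 ‖iteratedFDeriv ℝ m (fun z ↦ Kerr.bilin M 0 (z - c) - Minkowski.bilin) y‖ ≤ max C₀ 1 * |M| / E4.spatialNorm (y - c) ^ (m + 1) := by
    intro M c y hy
    obtain ⟨j0, j1, j2, jm⟩ := hC₀ M c y hy
    have h1 : C₀ * |M| / E4.spatialNorm (y - c) ≤ max C₀ 1 * |M| / E4.spatialNorm (y - c) := by
      gcongr; exact le_max_left _ _
    exact ⟨j0.trans h1, j1.trans (hle M _ 2 hy), j2.trans (hle M _ 3 hy),
      fun m hm ↦ (jm m hm).trans (hle M _ (m + 1) hy)⟩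
  have hDsep0 : 0 ≤ Dsep := by linarith [E4.spatialNorm_nonneg x]
  have hc₂ : E4.spatialNorm (E4.ofTimeSpace 0 (Dsep • e)) = Dsep := spatialNorm_centre hDsep0 he
  have key := ricAt_dragged_le_core hCK1 hKS hM₁ hM₂ hc₂ hx0 hd hD
  simpa only [boostedKerrBilin_one_zero, Theorems.boostedKerrBilin_one, sub_zero] using key

end Summit.FinalStateConjecture.FinalStateConjecture.Cruxes.ModulatedKerrHandoff.OverlapModulationSecondIterate

end
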